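import Literature.MathematicalPhysics.QuantumFieldTheory.Balaban1983to89.B8Thm4CoreZdGF3HPLanEGamma
import Literature.MathematicalPhysics.QuantumFieldTheory.Balaban1983to89.B8

/-!
# `Balaban1983to89.B8Thm4ZdGF3PGammaPrime` — [Balaban1985RegularSpaces] THEOREM 4 (p. 88) AS THE LEAF FACES `B8.Thm4Body` ∕ `B8.Thm4Printed`
# ON THE P-CARRIER `zdGF3HP` ∕ `zdGF3P` OVER THE γ′ (ONE-END-POINT, SOURCED) SOCKET FAMILY OF RECORD, CONSTANT `B₁′ = 5dL·B₈`

statement-level skeleton of published theorems with citation tags; proofs where landed; nothing here is a claim about the Yang–Mills mass gap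

T. Bałaban, *Spaces of regular gauge field configurations on a lattice and gauge fixing conditions*, Commun. Math. Phys. **99** (1985) 75–102
`[Balaban1985RegularSpaces]` ("B8"; journal page = PDF page + 74): Thm 4 p. 88 («B′₁ = C′₁B₁»), (1.29) p. 81, (1.33)–(1.35), (1.37)–(1.38) p. 82,
(1.62) p. 87, (1.66) p. 87, p. 77 (the one-end-point bond convention), Thm 8 (1.146) p. 101 (the sourced gauge condition).

## WHY THIS FILE (cell `pub-ymgap`, HUMAN RULING D-0149 width push; seat `pub-ymgap-dag-n05-w2`, WIDTH SEAT 2 of 4 on NODE n05 = [B8]; count-neutral)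

The (D4″) item of the §n05 γ chain.  dag-n05-d's `B8Thm4CoreZdGF3HPLanEGamma.thm4Core_zdGF3HP_lanE_γ'` is the Theorem-4-shaped CORE at the
P-carrier `B8LeafModelZd3P.zdGF3HP` (dag-n05-w1): print's averaging class `towerBondsP`, the carrier's ONE-END-POINT (1.35)∕(1.66) letter, a
SOURCE-indexed gauge predicate `LanF i U₀ φ m` with admissibility `Adm i φ U₀ α₀ α₁` (Theorem 8's reading: `φ` = the source `f` of (1.146)), and the
four member sockets `SP5base` ∕ `SP5` ∕ `SH59src` ∕ `SP5u` whose (1.35) antecedent is the SAME one-end-point letter — the socket family dag-n05-w4's γ′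
providers target.  THIS FILE reads the leaf faces of THEOREM 4 off that core AT A ZERO SOURCE `φ₀` (admitted everywhere, `LanF i U₀ φ₀ i.k = ` the
carrier's (1.38) `Landau`): ★ `thm4Body_member_zdGF3HP_γ'` (`B8.Thm4Body c₁ (5dL·B₈)` at one member, modulo the member's tower law at every
truncation), ★★ `thm4Printed_zdGF3HP_map_γ'` (`B8.Thm4Printed (5dL·B₈)` on any index-mapped sub-family; the `zdGF3P` faces are the SAME terms, since
`(zdGF3HP …).toGFData = (zdGF3P …).toGFData` by `rfl`, dag-n05-w1's `B8LeafModelZd3P.zdGF3HP_toGFData`).  Relative to this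
seat's γ edition `B8Thm4Zd3Gamma.thm4Printed_zd3P_map_γ` (p589244): the sockets' (1.35) antecedent is the carrier's own letter (not the box form
«box ⊂ Ω_j»), so ONE socket family serves Theorems 2 ∕ 4 ∕ 8 of the P-slot, and Theorem 4's constant is print's `5dL·B₈` (no bridge inflation).
In Theorem 8's reading (`Φ := Site d → 𝔸`, `Adm i f U₀ α₀ α₁ := InR … f ∧ … ∧ fNorm f ≤ γ(α₀ + α₁)`, `LanF i U₀ f m W := IsLandau146W L m i.η (i.Ω 0) (i.Λs m) U₀ f W`)
the zero-source hypotheses are `B8Eq138LandauZd.inR138_zero`, `fNorm 0 = 0 ≤ γ(α₀ + α₁)` and `B8Eq138LandauZd.isLandau146W_zero_iff`.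

## HONEST SCOPE

An assembly BY NAME (field matching on dag-n05-d's core; `Reg335` and the competitor's (1.37) are not read, as in print's proof); NO estimate proved
anew; the four sourced sockets are HYPOTHESES per member (A6: providers = dag-n05-w4's γ′ chain modulo [4]'s letters; m = 0 inhabited by the tree's
`Ω₀ = ℤᵈ` suppliers, m ≥ 1 = N06 content, OPEN); no joint-satisfiability claim.  `d, L ≥ 2`; `T_η ↦ ℤᵈ`; `≤` for print's `<`.  Count-neutral; N05 NOT
discharged; no count claim; one finite `T⁴` programme at fixed `ε`, Bałaban AS PRINTED; the Yang–Mills mass gap (Clay) is NOT proved by any of this —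
R4 closes the conditional finite-𝕋⁴ rung `BalabanLadder.UV` only; nothing continuum ∕ ℝ⁴ ∕ OS.  No `sorry`, no `axiom`, no definition, no `instance`.
Unit `pub-ymgap-dag-n05-w2` (g0), 2026-08-28.

[cite: Balaban1985RegularSpaces, Thm 4 p.88, (1.29) p.81, (1.37)–(1.38) p.82, (1.62) p.87, (1.66) p.87, p.77, Thm 8 (1.146) p.101, Prop. 5 (1.107)–(1.109) p.94]
-/

noncomputable section

open NormedSpace

namespace Literature.MathematicalPhysics.QuantumFieldTheory.Balaban1983to89.B8Thm4ZdGF3PGammaPrime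

open Complex (I)
open MatrixLog B7Prop1Explicit B7Prop2Explicit B7Prop1Local B7Eq92Concrete
open B7Prop2Explicit (C0 c2' unitaryUnits unitaryUnits_le_U1)
open B8Ineq132 (covDerivFwd InAk BondTouches)
open B8Eq119TwistedAxial (Restr129 InAx)
open B8Eq184Proof (gaugeExp cfgExp)
open B8Lemma1NonAbelian (mulCfg)
open B8Eq140Level (SideTouches)
open B8Eq146AExpansion (iEta)
open B7Prop4GeneralLevels (logCovIter linCovIter)
open B8Eq155JBound (Jcur wsup)
open B8ScaledSupNorm (bondNorm msup)
open B8Thm2LogB (blockTop)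
open B8Ineq130 (tlo thi)
open B8Eq138LandauZd (logCfg)
open B8Prop3GaugeFixedKLevel (mem_unitaryUnits_of_mgauge_eq)
open B8Thm4AtLandau138 (mgauge_mgauge_inv)
open B8Thm4ConcreteLanEGamma (thm4Body_concrete_uniform_lanE_γ')
open B8Thm4Windows (thm4_windows thm4_windows_extra)
open B8Thm4ExistsConcreteGamma (thm4_windows_γ)
open B8LeafModelZd (ZdIdx)
open B8LeafModelZd3 (zdGF3 mlogCfg mlogCfg_spec)
open B8LeafModelZd3P (zdGF3P zdGF3HP)
open B8TowerBondsPrinted (towerBondsP)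

open B8Thm4CoreZdGF3HPLanEGamma (thm4Core_zdGF3HP_lanE_γ')
open B8Eq138LandauZd (IsLandau138W)

-- `Site` alone could resolve to the torus sites of `Setup.lean`; re-export the `ℤ^d` sites of `B7Prop1Explicit`.
export B7Prop1Explicit (Site)

variable {d : ℕ}

section Faces

variable {𝔸 : Type} [CStarAlgebra 𝔸] [Nontrivial 𝔸]

/-- ★ **`B8.Thm4Body c₁ (5dL·B₈)` AT ONE MEMBER OF THE P-CARRIER `zdGF3HP`, γ′ SOCKET FAMILY, ZERO SOURCE** (Theorem 4, p. 88): dag-n05-d's core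
`thm4Core_zdGF3HP_lanE_γ'` at an everywhere-admitted source `φ₀` whose level-`k` gauge condition `LanF i U₀ φ₀ i.k` IS the carrier's (1.38) `Landau`
(`IsLandau138W L i.k i.η (i.Ω 0) (i.Λs i.k)`); the leaf's `Reg335` hypothesis and the competitor's (1.37) are not read.  Hypotheses = the core's verbatim
(source data `Φ, γ′, B₈, Adm, LanF`; the four sourced member sockets with the one-end-point (1.35) antecedent) + the zero-source triple
`(φ₀, hAdm₀, hLan₀)`; per member, the tower law at every truncation ((1.5)–(1.6) p. 77; `IdxB8Sub.tower_all` at the law members).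
[cite: Balaban1985RegularSpaces, Thm 4 p.88, (1.29) p.81, (1.37)–(1.38) p.82, (1.62) p.87, Thm 8 (1.146) p.101] -/
theorem thm4Body_member_zdGF3HP_γ' (hd2 : 2 ≤ d) {L : ℕ} (hL : 2 ≤ L) {β : ℝ} {len : Site d → ℝ} {B₀ B₀' cu cP : ℝ} (hB₀ : 0 < B₀)
    (hB₀' : 0 < B₀') (hcu : 0 < cu) (hcP : 0 < cP)
    {Φ : Type*} {γ' B₈ : ℝ} (hγ' : 0 ≤ γ') (hB₈ : 0 < B₈) (hB₀8 : B₀ ≤ B₈) (hB : 2 ≤ 5 * (d : ℝ) * L * B₈)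
    (hγB : 5 * (d : ℝ) * L * B₀ + 2 * (γ' * B₀) ≤ 5 * (d : ℝ) * L * B₈)
    (Adm : ZdIdx d L → Φ → (Site d → Fin d → 𝔸ˣ) → ℝ → ℝ → Prop)
    (LanF : ZdIdx d L → (Site d → Fin d → 𝔸ˣ) → Φ → ℕ → (Site d → Fin d → 𝔸ˣ) → Prop)
    (SP5base : ∀ i : ZdIdx d L, ∀ α₀ α₁ : ℝ, 0 < α₀ → 0 < α₁ → α₀ + α₁ ≤ cP →
      ∀ U₀ U' : Site d → Fin d → 𝔸ˣ, (∀ x κ, U₀ x κ ∈ unitaryUnits 𝔸) → (∀ x κ, U' x κ ∈ unitaryUnits 𝔸) →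
      ∀ φ : Φ, Adm i φ U₀ α₀ α₁ →
      InAk L i.k i.η α₀ i.Ω U₀ → InAk L i.k i.η α₀ i.Ω (mulCfg U' U₀) → (∀ m, m ≤ i.k → InAx L m (i.Λs m) U₀ (mulCfg U' U₀)) →
      (∀ j, j ≤ i.k → ∀ (z : Site d) (μ : Fin d),
        ((∀ x, InBox (tlo L z j) (thi L z j) x → x ∈ i.Ω j) ∨ (∀ x, InBox (tlo L (z + e μ) j) (thi L (z + e μ) j) x → x ∈ i.Ω j)) →
        ‖(avgIter L (mulCfg U' U₀) j z μ : 𝔸) - (avgIter L U₀ j z μ : 𝔸)‖ ≤ α₁) →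
      (∀ b ∈ {b : Site d × Fin d | SideTouches (i.Ω 0) b.1 b.2}, ‖((U' b.1 b.2 : 𝔸ˣ) : 𝔸) - 1‖ ≤ α₁) →
      (∃ (v : Site d → 𝔸ˣ) (lam : Site d → 𝔸), (∀ x, v x ∈ unitaryUnits 𝔸) ∧ (∀ x, x ∉ i.Ω 0 → v x = 1) ∧
        (∀ j, j ≤ 1 → ∀ b ∈ {b : Site d × Fin d | SideTouches (i.Ω j) b.1 b.2}, (v b.1 : 𝔸) = ((gaugeExp lam b.1 : 𝔸ˣ) : 𝔸) ∧
        (v (b.1 + e b.2) : 𝔸) = ((gaugeExp lam (b.1 + e b.2) : 𝔸ˣ) : 𝔸)) ∧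
        (∀ j, j ≤ 1 → ∀ b ∈ {b : Site d × Fin d | SideTouches (i.Ω j) b.1 b.2},
        ‖lam b.1‖ ≤ (8 * B₀' * (5 * (d : ℝ) * L * B₈) * (α₀ + α₁)) ∧ ((L : ℝ) ^ j * i.η) * ‖covDerivFwd i.η U₀ b.2 lam b.1‖ ≤ (8 * B₀' * (5 * (d : ℝ) * L * B₈) * (α₀ + α₁))) ∧
        LanF i U₀ φ 1 (mgauge U₀ v⁻¹ U') ∧ Restr129 L 1 (i.Λs 1) U₀ ((1 : Site d → 𝔸ˣ) * v)))
    (SP5 : ∀ i : ZdIdx d L, ∀ α₀ α₁ : ℝ, 0 < α₀ → 0 < α₁ → α₀ + α₁ ≤ cP →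
      ∀ U₀ U' : Site d → Fin d → 𝔸ˣ, (∀ x κ, U₀ x κ ∈ unitaryUnits 𝔸) → (∀ x κ, U' x κ ∈ unitaryUnits 𝔸) →
      ∀ φ : Φ, Adm i φ U₀ α₀ α₁ →
      InAk L i.k i.η α₀ i.Ω U₀ → InAk L i.k i.η α₀ i.Ω (mulCfg U' U₀) → (∀ m, m ≤ i.k → InAx L m (i.Λs m) U₀ (mulCfg U' U₀)) →
      (∀ j, j ≤ i.k → ∀ (z : Site d) (μ : Fin d),
        ((∀ x, InBox (tlo L z j) (thi L z j) x → x ∈ i.Ω j) ∨ (∀ x, InBox (tlo L (z + e μ) j) (thi L (z + e μ) j) x → x ∈ i.Ω j)) →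
        ‖(avgIter L (mulCfg U' U₀) j z μ : 𝔸) - (avgIter L U₀ j z μ : 𝔸)‖ ≤ α₁) →
      (∀ b ∈ {b : Site d × Fin d | SideTouches (i.Ω 0) b.1 b.2}, ‖((U' b.1 b.2 : 𝔸ˣ) : 𝔸) - 1‖ ≤ α₁) →
      (∀ m, 1 ≤ m → m < i.k → ∀ (u₁ : Site d → 𝔸ˣ) (U₁ : Site d → Fin d → 𝔸ˣ) (A : Site d → Fin d → 𝔸),
        (∀ x, u₁ x ∈ unitaryUnits 𝔸) → (∀ x, x ∉ i.Ω 0 → u₁ x = 1) → mgauge U₀ u₁ U₁ = U' → Restr129 L m (i.Λs m) U₀ u₁ →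
        LanF i U₀ φ m U₁ →
        (∀ j, j ≤ m → ∀ b ∈ {b : Site d × Fin d | SideTouches (i.Ω j) b.1 b.2},
        U₁ b.1 b.2 = cfgExp i.η A b.1 b.2 ∧ IsSelfAdjoint (A b.1 b.2) ∧ ‖A b.1 b.2‖ ≤ (5 * (d : ℝ) * L * B₈ * (α₀ + α₁)) * ((L : ℝ) ^ j * i.η)⁻¹) →
        ∃ (v : Site d → 𝔸ˣ) (lam : Site d → 𝔸), (∀ x, v x ∈ unitaryUnits 𝔸) ∧ (∀ x, x ∉ i.Ω 0 → v x = 1) ∧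
        (∀ j, j ≤ m + 1 → ∀ b ∈ {b : Site d × Fin d | SideTouches (i.Ω j) b.1 b.2}, (v b.1 : 𝔸) = ((gaugeExp lam b.1 : 𝔸ˣ) : 𝔸) ∧
        (v (b.1 + e b.2) : 𝔸) = ((gaugeExp lam (b.1 + e b.2) : 𝔸ˣ) : 𝔸)) ∧
        (∀ j, j ≤ m + 1 → ∀ b ∈ {b : Site d × Fin d | SideTouches (i.Ω j) b.1 b.2},
        ‖lam b.1‖ ≤ (8 * B₀' * (5 * (d : ℝ) * L * B₈) * (α₀ + α₁)) ∧ ((L : ℝ) ^ j * i.η) * ‖covDerivFwd i.η U₀ b.2 lam b.1‖ ≤ (8 * B₀' * (5 * (d : ℝ) * L * B₈) * (α₀ + α₁))) ∧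
        LanF i U₀ φ (m + 1) (mgauge U₀ v⁻¹ U₁) ∧ Restr129 L (m + 1) (i.Λs (m + 1)) U₀ (u₁ * v)))
    (SH59src : ∀ i : ZdIdx d L, ∀ α₀ α₁ : ℝ, 0 < α₀ → 0 < α₁ → α₀ + α₁ ≤ cP →
      ∀ U₀ U' : Site d → Fin d → 𝔸ˣ, (∀ x κ, U₀ x κ ∈ unitaryUnits 𝔸) → (∀ x κ, U' x κ ∈ unitaryUnits 𝔸) →
      ∀ φ : Φ, Adm i φ U₀ α₀ α₁ →
      InAk L i.k i.η α₀ i.Ω U₀ → InAk L i.k i.η α₀ i.Ω (mulCfg U' U₀) → (∀ m, m ≤ i.k → InAx L m (i.Λs m) U₀ (mulCfg U' U₀)) →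
      (∀ j, j ≤ i.k → ∀ (z : Site d) (μ : Fin d),
        ((∀ x, InBox (tlo L z j) (thi L z j) x → x ∈ i.Ω j) ∨ (∀ x, InBox (tlo L (z + e μ) j) (thi L (z + e μ) j) x → x ∈ i.Ω j)) →
        ‖(avgIter L (mulCfg U' U₀) j z μ : 𝔸) - (avgIter L U₀ j z μ : 𝔸)‖ ≤ α₁) →
      (∀ b ∈ {b : Site d × Fin d | SideTouches (i.Ω 0) b.1 b.2}, ‖((U' b.1 b.2 : 𝔸ˣ) : 𝔸) - 1‖ ≤ α₁) →
      (∀ m, 1 ≤ m → m ≤ i.k → ∀ (u : Site d → 𝔸ˣ) (W : Site d → Fin d → 𝔸ˣ) (A' : Site d → Fin d → 𝔸),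
        (∀ x, u x ∈ unitaryUnits 𝔸) → mgauge U₀ u W = U' → Restr129 L m (i.Λs m) U₀ u → LanF i U₀ φ m W →
        (∀ y τ, IsSelfAdjoint (A' y τ)) →
        (∀ j, j ≤ m → ∀ y τ, SideTouches (i.Ω j) y τ →
        W y τ = cfgExp i.η A' y τ ∧ ‖A' y τ‖ ≤ (2 * (L * (5 * (d : ℝ) * L * B₈ * (α₀ + α₁))) + 8 * (8 * B₀' * (5 * (d : ℝ) * L * B₈) * (α₀ + α₁))) * ((L : ℝ) ^ j * i.η)⁻¹) →
        (∀ y τ, (∀ j, j ≤ m → ¬ SideTouches (i.Ω j) y τ) → A' y τ = 0) →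
        msup L m i.η (-(1 : ℝ)) (fun j (b : Site d × Fin d) => SideTouches (i.Ω j) b.1 b.2) (fun b => A' b.1 b.2)
        ≤ B₀ * (bondNorm L m i.η (-(3 : ℝ)) i.Ω (fun x μ => Jcur i.η U₀ A' μ x)
        + wsup 1 (fun p : {p : ℕ × (Site d × Fin d) // p.1 ≤ m ∧ p.2 ∈ towerBondsP L i.Ω (i.Λs m) p.1} =>
        linCovIter L U₀ (iEta i.η A') p.1.1 p.1.2.1 p.1.2.2)) + γ' * B₀ * (α₀ + α₁) ∧
        msup L m i.η (-(2 : ℝ)) (fun j (t : Fin d × Fin d × Site d) => SideTouches (i.Ω j) t.2.2 t.2.1)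
        (fun t => covDerivFwd i.η U₀ t.1 (fun z => A' z t.2.1) t.2.2)
        ≤ B₀ * (bondNorm L m i.η (-(3 : ℝ)) i.Ω (fun x μ => Jcur i.η U₀ A' μ x)
        + wsup 1 (fun p : {p : ℕ × (Site d × Fin d) // p.1 ≤ m ∧ p.2 ∈ towerBondsP L i.Ω (i.Λs m) p.1} =>
        linCovIter L U₀ (iEta i.η A') p.1.1 p.1.2.1 p.1.2.2)) + γ' * B₀ * (α₀ + α₁)))
    (SP5u : ∀ i : ZdIdx d L, ∀ α₀ α₁ : ℝ, 0 < α₀ → 0 < α₁ → α₀ + α₁ ≤ cP →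
      ∀ U₀ U' : Site d → Fin d → 𝔸ˣ, (∀ x κ, U₀ x κ ∈ unitaryUnits 𝔸) → (∀ x κ, U' x κ ∈ unitaryUnits 𝔸) →
      ∀ φ : Φ, Adm i φ U₀ α₀ α₁ →
      InAk L i.k i.η α₀ i.Ω U₀ → InAk L i.k i.η α₀ i.Ω (mulCfg U' U₀) → (∀ m, m ≤ i.k → InAx L m (i.Λs m) U₀ (mulCfg U' U₀)) →
      (∀ j, j ≤ i.k → ∀ (z : Site d) (μ : Fin d),
        ((∀ x, InBox (tlo L z j) (thi L z j) x → x ∈ i.Ω j) ∨ (∀ x, InBox (tlo L (z + e μ) j) (thi L (z + e μ) j) x → x ∈ i.Ω j)) →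
        ‖(avgIter L (mulCfg U' U₀) j z μ : 𝔸) - (avgIter L U₀ j z μ : 𝔸)‖ ≤ α₁) →
      (∀ b ∈ {b : Site d × Fin d | SideTouches (i.Ω 0) b.1 b.2}, ‖((U' b.1 b.2 : 𝔸ˣ) : 𝔸) - 1‖ ≤ α₁) →
      ∀ u₁ : Site d → 𝔸ˣ, (∀ x, u₁ x ∈ unitaryUnits 𝔸) → (∀ x, x ∉ i.Ω 0 → u₁ x = 1) → Restr129 L i.k (i.Λs i.k) U₀ u₁ →
      LanF i U₀ φ i.k (mgauge U₀ u₁⁻¹ U') →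
      (∃ A₁ : Site d → Fin d → 𝔸, ∀ j, j ≤ i.k → ∀ (x : Site d) (κ : Fin d), SideTouches (i.Ω j) x κ →
        mgauge U₀ u₁⁻¹ U' x κ = cfgExp i.η A₁ x κ ∧ ‖A₁ x κ‖ ≤ (5 * (d : ℝ) * L * B₈ * (α₀ + α₁)) * ((L : ℝ) ^ j * i.η)⁻¹) →
      ∀ (v w : Site d → 𝔸ˣ) (lam mu : Site d → 𝔸),
      (∀ x, ((gaugeExp lam x : 𝔸ˣ) : 𝔸) = ((v x : 𝔸ˣ) : 𝔸) ∧ IsSelfAdjoint (lam x) ∧ ‖lam x‖ < cu) → (∀ x, x ∉ i.Ω 0 → lam x = 0) →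
      (∀ j, j ≤ i.k → ∀ b ∈ {b : Site d × Fin d | SideTouches (i.Ω j) b.1 b.2}, ((L : ℝ) ^ j * i.η) * ‖covDerivFwd i.η U₀ b.2 lam b.1‖ < cu) →
      (∀ x, ((gaugeExp mu x : 𝔸ˣ) : 𝔸) = ((w x : 𝔸ˣ) : 𝔸) ∧ IsSelfAdjoint (mu x) ∧ ‖mu x‖ < cu) → (∀ x, x ∉ i.Ω 0 → mu x = 0) →
      (∀ j, j ≤ i.k → ∀ b ∈ {b : Site d × Fin d | SideTouches (i.Ω j) b.1 b.2}, ((L : ℝ) ^ j * i.η) * ‖covDerivFwd i.η U₀ b.2 mu b.1‖ < cu) →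
      LanF i U₀ φ i.k (mgauge U₀ v⁻¹ (mgauge U₀ u₁⁻¹ U')) → Restr129 L i.k (i.Λs i.k) U₀ (u₁ * v) →
      LanF i U₀ φ i.k (mgauge U₀ w⁻¹ (mgauge U₀ u₁⁻¹ U')) → Restr129 L i.k (i.Λs i.k) U₀ (u₁ * w) →
      ∀ x, v x = w x)
    -- the ZERO SOURCE: admitted at every member ∕ pair ∕ background, its level-`k` gauge condition = the carrier's (1.38)
    (φ₀ : Φ) (hAdm₀ : ∀ i : ZdIdx d L, ∀ α₀ α₁ : ℝ, 0 < α₀ → 0 < α₁ → ∀ U₀ : Site d → Fin d → 𝔸ˣ, (∀ x κ, U₀ x κ ∈ unitaryUnits 𝔸) →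
      Adm i φ₀ U₀ α₀ α₁)
    (hLan₀ : ∀ i : ZdIdx d L, ∀ U₀ W : Site d → Fin d → 𝔸ˣ, LanF i U₀ φ₀ i.k W ↔ IsLandau138W L i.k i.η (i.Ω 0) (i.Λs i.k) U₀ W) :
    ∃ c₁ : ℝ, 0 < c₁ ∧ ∀ i : ZdIdx d L,
      (∀ m, m ≤ i.k → ∀ j, j ≤ m → ∀ y ∈ i.Λs m j, ∀ x, InBox (tlo L y j) (thi L y j) x → x ∈ i.Ω j) →
      B8.Thm4Body c₁ (5 * (d : ℝ) * L * B₈) (fun _ : Unit => (zdGF3HP 𝔸 L β len i).toGFData) := by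
  obtain ⟨c₁, hc₁, H⟩ := thm4Core_zdGF3HP_lanE_γ' (𝔸 := 𝔸) (β := β) (len := len) hd2 hL hB₀ hB₀' hcu hcP hγ' hB₈ hB₀8 hB hγB Adm LanF
    SP5base SP5 SH59src SP5u
  refine ⟨c₁, hc₁, fun i htw => ?_⟩
  intro _ α₀ α₁ hα₀ hα₁ hs U₀ P hInA _ hInAAx h166
  obtain ⟨u, hu, ⟨h137, hLan, h162⟩, huniq⟩ :=
    H i htw α₀ α₁ hα₀ hα₁ hs U₀ P φ₀ (hAdm₀ i α₀ α₁ hα₀ hα₁ U₀.1 U₀.2) hInA hInAAx h166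
  exact ⟨u, hu, ⟨h137, (hLan₀ i U₀.1 _).1 hLan, h162⟩, fun u' hu' _ hLan' h162' => huniq u' hu' ((hLan₀ i U₀.1 _).2 hLan') h162'⟩

/-- ★★ **`B8.Thm4Printed (5dL·B₈)` ON ANY INDEX-MAPPED SUB-FAMILY OF THE P-CARRIER `zdGF3HP`, γ′ SOCKET FAMILY, ZERO SOURCE** (Theorem 4 «there exists a
constant c₁ … exactly one», p. 88; «B′₁ = C′₁B₁»): `thm4Body_member_zdGF3HP_γ'` along `ι : J → ZdIdx d L`, the members' tower laws supplied
(`htw`; at NODE 00's law members `IdxB8Sub.tower_all`). [cite: Balaban1985RegularSpaces, Thm 4 p.88, (1.62)∕(1.67) pp.87–88] -/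
theorem thm4Printed_zdGF3HP_map_γ' (hd2 : 2 ≤ d) {L : ℕ} (hL : 2 ≤ L) {β : ℝ} {len : Site d → ℝ} {B₀ B₀' cu cP : ℝ} (hB₀ : 0 < B₀)
    (hB₀' : 0 < B₀') (hcu : 0 < cu) (hcP : 0 < cP)
    {Φ : Type*} {γ' B₈ : ℝ} (hγ' : 0 ≤ γ') (hB₈ : 0 < B₈) (hB₀8 : B₀ ≤ B₈) (hB : 2 ≤ 5 * (d : ℝ) * L * B₈)
    (hγB : 5 * (d : ℝ) * L * B₀ + 2 * (γ' * B₀) ≤ 5 * (d : ℝ) * L * B₈)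
    (Adm : ZdIdx d L → Φ → (Site d → Fin d → 𝔸ˣ) → ℝ → ℝ → Prop)
    (LanF : ZdIdx d L → (Site d → Fin d → 𝔸ˣ) → Φ → ℕ → (Site d → Fin d → 𝔸ˣ) → Prop)
    (SP5base : ∀ i : ZdIdx d L, ∀ α₀ α₁ : ℝ, 0 < α₀ → 0 < α₁ → α₀ + α₁ ≤ cP →
      ∀ U₀ U' : Site d → Fin d → 𝔸ˣ, (∀ x κ, U₀ x κ ∈ unitaryUnits 𝔸) → (∀ x κ, U' x κ ∈ unitaryUnits 𝔸) →
      ∀ φ : Φ, Adm i φ U₀ α₀ α₁ →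
      InAk L i.k i.η α₀ i.Ω U₀ → InAk L i.k i.η α₀ i.Ω (mulCfg U' U₀) → (∀ m, m ≤ i.k → InAx L m (i.Λs m) U₀ (mulCfg U' U₀)) →
      (∀ j, j ≤ i.k → ∀ (z : Site d) (μ : Fin d),
        ((∀ x, InBox (tlo L z j) (thi L z j) x → x ∈ i.Ω j) ∨ (∀ x, InBox (tlo L (z + e μ) j) (thi L (z + e μ) j) x → x ∈ i.Ω j)) →
        ‖(avgIter L (mulCfg U' U₀) j z μ : 𝔸) - (avgIter L U₀ j z μ : 𝔸)‖ ≤ α₁) →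
      (∀ b ∈ {b : Site d × Fin d | SideTouches (i.Ω 0) b.1 b.2}, ‖((U' b.1 b.2 : 𝔸ˣ) : 𝔸) - 1‖ ≤ α₁) →
      (∃ (v : Site d → 𝔸ˣ) (lam : Site d → 𝔸), (∀ x, v x ∈ unitaryUnits 𝔸) ∧ (∀ x, x ∉ i.Ω 0 → v x = 1) ∧
        (∀ j, j ≤ 1 → ∀ b ∈ {b : Site d × Fin d | SideTouches (i.Ω j) b.1 b.2}, (v b.1 : 𝔸) = ((gaugeExp lam b.1 : 𝔸ˣ) : 𝔸) ∧
        (v (b.1 + e b.2) : 𝔸) = ((gaugeExp lam (b.1 + e b.2) : 𝔸ˣ) : 𝔸)) ∧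
        (∀ j, j ≤ 1 → ∀ b ∈ {b : Site d × Fin d | SideTouches (i.Ω j) b.1 b.2},
        ‖lam b.1‖ ≤ (8 * B₀' * (5 * (d : ℝ) * L * B₈) * (α₀ + α₁)) ∧ ((L : ℝ) ^ j * i.η) * ‖covDerivFwd i.η U₀ b.2 lam b.1‖ ≤ (8 * B₀' * (5 * (d : ℝ) * L * B₈) * (α₀ + α₁))) ∧
        LanF i U₀ φ 1 (mgauge U₀ v⁻¹ U') ∧ Restr129 L 1 (i.Λs 1) U₀ ((1 : Site d → 𝔸ˣ) * v)))
    (SP5 : ∀ i : ZdIdx d L, ∀ α₀ α₁ : ℝ, 0 < α₀ → 0 < α₁ → α₀ + α₁ ≤ cP →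
      ∀ U₀ U' : Site d → Fin d → 𝔸ˣ, (∀ x κ, U₀ x κ ∈ unitaryUnits 𝔸) → (∀ x κ, U' x κ ∈ unitaryUnits 𝔸) →
      ∀ φ : Φ, Adm i φ U₀ α₀ α₁ →
      InAk L i.k i.η α₀ i.Ω U₀ → InAk L i.k i.η α₀ i.Ω (mulCfg U' U₀) → (∀ m, m ≤ i.k → InAx L m (i.Λs m) U₀ (mulCfg U' U₀)) →
      (∀ j, j ≤ i.k → ∀ (z : Site d) (μ : Fin d),
        ((∀ x, InBox (tlo L z j) (thi L z j) x → x ∈ i.Ω j) ∨ (∀ x, InBox (tlo L (z + e μ) j) (thi L (z + e μ) j) x → x ∈ i.Ω j)) →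
        ‖(avgIter L (mulCfg U' U₀) j z μ : 𝔸) - (avgIter L U₀ j z μ : 𝔸)‖ ≤ α₁) →
      (∀ b ∈ {b : Site d × Fin d | SideTouches (i.Ω 0) b.1 b.2}, ‖((U' b.1 b.2 : 𝔸ˣ) : 𝔸) - 1‖ ≤ α₁) →
      (∀ m, 1 ≤ m → m < i.k → ∀ (u₁ : Site d → 𝔸ˣ) (U₁ : Site d → Fin d → 𝔸ˣ) (A : Site d → Fin d → 𝔸),
        (∀ x, u₁ x ∈ unitaryUnits 𝔸) → (∀ x, x ∉ i.Ω 0 → u₁ x = 1) → mgauge U₀ u₁ U₁ = U' → Restr129 L m (i.Λs m) U₀ u₁ →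
        LanF i U₀ φ m U₁ →
        (∀ j, j ≤ m → ∀ b ∈ {b : Site d × Fin d | SideTouches (i.Ω j) b.1 b.2},
        U₁ b.1 b.2 = cfgExp i.η A b.1 b.2 ∧ IsSelfAdjoint (A b.1 b.2) ∧ ‖A b.1 b.2‖ ≤ (5 * (d : ℝ) * L * B₈ * (α₀ + α₁)) * ((L : ℝ) ^ j * i.η)⁻¹) →
        ∃ (v : Site d → 𝔸ˣ) (lam : Site d → 𝔸), (∀ x, v x ∈ unitaryUnits 𝔸) ∧ (∀ x, x ∉ i.Ω 0 → v x = 1) ∧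
        (∀ j, j ≤ m + 1 → ∀ b ∈ {b : Site d × Fin d | SideTouches (i.Ω j) b.1 b.2}, (v b.1 : 𝔸) = ((gaugeExp lam b.1 : 𝔸ˣ) : 𝔸) ∧
        (v (b.1 + e b.2) : 𝔸) = ((gaugeExp lam (b.1 + e b.2) : 𝔸ˣ) : 𝔸)) ∧
        (∀ j, j ≤ m + 1 → ∀ b ∈ {b : Site d × Fin d | SideTouches (i.Ω j) b.1 b.2},
        ‖lam b.1‖ ≤ (8 * B₀' * (5 * (d : ℝ) * L * B₈) * (α₀ + α₁)) ∧ ((L : ℝ) ^ j * i.η) * ‖covDerivFwd i.η U₀ b.2 lam b.1‖ ≤ (8 * B₀' * (5 * (d : ℝ) * L * B₈) * (α₀ + α₁))) ∧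
        LanF i U₀ φ (m + 1) (mgauge U₀ v⁻¹ U₁) ∧ Restr129 L (m + 1) (i.Λs (m + 1)) U₀ (u₁ * v)))
    (SH59src : ∀ i : ZdIdx d L, ∀ α₀ α₁ : ℝ, 0 < α₀ → 0 < α₁ → α₀ + α₁ ≤ cP →
      ∀ U₀ U' : Site d → Fin d → 𝔸ˣ, (∀ x κ, U₀ x κ ∈ unitaryUnits 𝔸) → (∀ x κ, U' x κ ∈ unitaryUnits 𝔸) →
      ∀ φ : Φ, Adm i φ U₀ α₀ α₁ →
      InAk L i.k i.η α₀ i.Ω U₀ → InAk L i.k i.η α₀ i.Ω (mulCfg U' U₀) → (∀ m, m ≤ i.k → InAx L m (i.Λs m) U₀ (mulCfg U' U₀)) →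
      (∀ j, j ≤ i.k → ∀ (z : Site d) (μ : Fin d),
        ((∀ x, InBox (tlo L z j) (thi L z j) x → x ∈ i.Ω j) ∨ (∀ x, InBox (tlo L (z + e μ) j) (thi L (z + e μ) j) x → x ∈ i.Ω j)) →
        ‖(avgIter L (mulCfg U' U₀) j z μ : 𝔸) - (avgIter L U₀ j z μ : 𝔸)‖ ≤ α₁) →
      (∀ b ∈ {b : Site d × Fin d | SideTouches (i.Ω 0) b.1 b.2}, ‖((U' b.1 b.2 : 𝔸ˣ) : 𝔸) - 1‖ ≤ α₁) →
      (∀ m, 1 ≤ m → m ≤ i.k → ∀ (u : Site d → 𝔸ˣ) (W : Site d → Fin d → 𝔸ˣ) (A' : Site d → Fin d → 𝔸),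
        (∀ x, u x ∈ unitaryUnits 𝔸) → mgauge U₀ u W = U' → Restr129 L m (i.Λs m) U₀ u → LanF i U₀ φ m W →
        (∀ y τ, IsSelfAdjoint (A' y τ)) →
        (∀ j, j ≤ m → ∀ y τ, SideTouches (i.Ω j) y τ →
        W y τ = cfgExp i.η A' y τ ∧ ‖A' y τ‖ ≤ (2 * (L * (5 * (d : ℝ) * L * B₈ * (α₀ + α₁))) + 8 * (8 * B₀' * (5 * (d : ℝ) * L * B₈) * (α₀ + α₁))) * ((L : ℝ) ^ j * i.η)⁻¹) →
        (∀ y τ, (∀ j, j ≤ m → ¬ SideTouches (i.Ω j) y τ) → A' y τ = 0) →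
        msup L m i.η (-(1 : ℝ)) (fun j (b : Site d × Fin d) => SideTouches (i.Ω j) b.1 b.2) (fun b => A' b.1 b.2)
        ≤ B₀ * (bondNorm L m i.η (-(3 : ℝ)) i.Ω (fun x μ => Jcur i.η U₀ A' μ x)
        + wsup 1 (fun p : {p : ℕ × (Site d × Fin d) // p.1 ≤ m ∧ p.2 ∈ towerBondsP L i.Ω (i.Λs m) p.1} =>
        linCovIter L U₀ (iEta i.η A') p.1.1 p.1.2.1 p.1.2.2)) + γ' * B₀ * (α₀ + α₁) ∧
        msup L m i.η (-(2 : ℝ)) (fun j (t : Fin d × Fin d × Site d) => SideTouches (i.Ω j) t.2.2 t.2.1)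
        (fun t => covDerivFwd i.η U₀ t.1 (fun z => A' z t.2.1) t.2.2)
        ≤ B₀ * (bondNorm L m i.η (-(3 : ℝ)) i.Ω (fun x μ => Jcur i.η U₀ A' μ x)
        + wsup 1 (fun p : {p : ℕ × (Site d × Fin d) // p.1 ≤ m ∧ p.2 ∈ towerBondsP L i.Ω (i.Λs m) p.1} =>
        linCovIter L U₀ (iEta i.η A') p.1.1 p.1.2.1 p.1.2.2)) + γ' * B₀ * (α₀ + α₁)))
    (SP5u : ∀ i : ZdIdx d L, ∀ α₀ α₁ : ℝ, 0 < α₀ → 0 < α₁ → α₀ + α₁ ≤ cP →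
      ∀ U₀ U' : Site d → Fin d → 𝔸ˣ, (∀ x κ, U₀ x κ ∈ unitaryUnits 𝔸) → (∀ x κ, U' x κ ∈ unitaryUnits 𝔸) →
      ∀ φ : Φ, Adm i φ U₀ α₀ α₁ →
      InAk L i.k i.η α₀ i.Ω U₀ → InAk L i.k i.η α₀ i.Ω (mulCfg U' U₀) → (∀ m, m ≤ i.k → InAx L m (i.Λs m) U₀ (mulCfg U' U₀)) →
      (∀ j, j ≤ i.k → ∀ (z : Site d) (μ : Fin d),
        ((∀ x, InBox (tlo L z j) (thi L z j) x → x ∈ i.Ω j) ∨ (∀ x, InBox (tlo L (z + e μ) j) (thi L (z + e μ) j) x → x ∈ i.Ω j)) →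
        ‖(avgIter L (mulCfg U' U₀) j z μ : 𝔸) - (avgIter L U₀ j z μ : 𝔸)‖ ≤ α₁) →
      (∀ b ∈ {b : Site d × Fin d | SideTouches (i.Ω 0) b.1 b.2}, ‖((U' b.1 b.2 : 𝔸ˣ) : 𝔸) - 1‖ ≤ α₁) →
      ∀ u₁ : Site d → 𝔸ˣ, (∀ x, u₁ x ∈ unitaryUnits 𝔸) → (∀ x, x ∉ i.Ω 0 → u₁ x = 1) → Restr129 L i.k (i.Λs i.k) U₀ u₁ →
      LanF i U₀ φ i.k (mgauge U₀ u₁⁻¹ U') →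
      (∃ A₁ : Site d → Fin d → 𝔸, ∀ j, j ≤ i.k → ∀ (x : Site d) (κ : Fin d), SideTouches (i.Ω j) x κ →
        mgauge U₀ u₁⁻¹ U' x κ = cfgExp i.η A₁ x κ ∧ ‖A₁ x κ‖ ≤ (5 * (d : ℝ) * L * B₈ * (α₀ + α₁)) * ((L : ℝ) ^ j * i.η)⁻¹) →
      ∀ (v w : Site d → 𝔸ˣ) (lam mu : Site d → 𝔸),
      (∀ x, ((gaugeExp lam x : 𝔸ˣ) : 𝔸) = ((v x : 𝔸ˣ) : 𝔸) ∧ IsSelfAdjoint (lam x) ∧ ‖lam x‖ < cu) → (∀ x, x ∉ i.Ω 0 → lam x = 0) →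
      (∀ j, j ≤ i.k → ∀ b ∈ {b : Site d × Fin d | SideTouches (i.Ω j) b.1 b.2}, ((L : ℝ) ^ j * i.η) * ‖covDerivFwd i.η U₀ b.2 lam b.1‖ < cu) →
      (∀ x, ((gaugeExp mu x : 𝔸ˣ) : 𝔸) = ((w x : 𝔸ˣ) : 𝔸) ∧ IsSelfAdjoint (mu x) ∧ ‖mu x‖ < cu) → (∀ x, x ∉ i.Ω 0 → mu x = 0) →
      (∀ j, j ≤ i.k → ∀ b ∈ {b : Site d × Fin d | SideTouches (i.Ω j) b.1 b.2}, ((L : ℝ) ^ j * i.η) * ‖covDerivFwd i.η U₀ b.2 mu b.1‖ < cu) →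
      LanF i U₀ φ i.k (mgauge U₀ v⁻¹ (mgauge U₀ u₁⁻¹ U')) → Restr129 L i.k (i.Λs i.k) U₀ (u₁ * v) →
      LanF i U₀ φ i.k (mgauge U₀ w⁻¹ (mgauge U₀ u₁⁻¹ U')) → Restr129 L i.k (i.Λs i.k) U₀ (u₁ * w) →
      ∀ x, v x = w x)
    (φ₀ : Φ) (hAdm₀ : ∀ i : ZdIdx d L, ∀ α₀ α₁ : ℝ, 0 < α₀ → 0 < α₁ → ∀ U₀ : Site d → Fin d → 𝔸ˣ, (∀ x κ, U₀ x κ ∈ unitaryUnits 𝔸) →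
      Adm i φ₀ U₀ α₀ α₁)
    (hLan₀ : ∀ i : ZdIdx d L, ∀ U₀ W : Site d → Fin d → 𝔸ˣ, LanF i U₀ φ₀ i.k W ↔ IsLandau138W L i.k i.η (i.Ω 0) (i.Λs i.k) U₀ W)
    {J : Type} (ι : J → ZdIdx d L)
    (htw : ∀ a : J, ∀ m, m ≤ (ι a).k → ∀ j, j ≤ m → ∀ y ∈ (ι a).Λs m j, ∀ x, InBox (tlo L y j) (thi L y j) x → x ∈ (ι a).Ω j) :
    B8.Thm4Printed (5 * (d : ℝ) * L * B₈) (fun a : J => (zdGF3HP 𝔸 L β len (ι a)).toGFData) := by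
  obtain ⟨c₁, hc₁, H⟩ := thm4Body_member_zdGF3HP_γ' (𝔸 := 𝔸) (β := β) (len := len) hd2 hL hB₀ hB₀' hcu hcP hγ' hB₈ hB₀8 hB hγB Adm LanF
    SP5base SP5 SH59src SP5u φ₀ hAdm₀ hLan₀
  exact ⟨c₁, hc₁, fun a => H (ι a) (htw a) ()⟩

end Faces

#print axioms thm4Body_member_zdGF3HP_γ'
#print axioms thm4Printed_zdGF3HP_map_γ'

end Literature.MathematicalPhysics.QuantumFieldTheory.Balaban1983to89.B8Thm4ZdGF3PGammaPrime

end
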